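import Summits.QuantumFields.YangMills.Theorems.BalabanUVNodesN15KingModelTwoPointInfiniteVolumeDecay

/-!
# BalabanUVNodes ∕ N15 — THE KING-MODEL RUNG (PART Ϸ-g): THE THERMODYNAMIC LIMIT OF THE TWO-POINT KERNEL AGAINST EVERY BOUNDED TEST FUNCTION —
# `Σ_{w∈Ω_k} S₂^{(∞)}_{Ω_k}(0,w)·h(w̃) → Σ_{z∈ℤ^{d+1}} S₂^{ℝ}(z)·h(z)` for every bounded `h : ℤ^{d+1} → ℝ` (the linear response of the free block field at the origin to a bounded
# external source converges; Tannery under part Ϝ-k's uniform exponential majorant)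
# (Track A, DAG node N15 = NE2; FAN-OUT v1.1 §N15 s3 «KING-MODEL RUNG»; uses part Ϝ-k (`repKernel`, `abs_repKernel_le`, `tendsto_repKernel`, `summable_kingS2Inf`); count-neutral)

HONEST FRAMING.  Count-neutral (cell `pub-ymgap`, seat `pub-ymgap-dag-n15-e` g34; `--supports stmt-QuantumFields-27366 --as helper` = K3⁸
`SpineGivenEndpointR13SepCoPHV`).  King's `A = 0`, `g = 0` model ([King1986] C. King, Commun. Math. Phys. **102** (1986) 649–677): part Ϝ-j∕Ϝ-k proved the
POINTWISE thermodynamic limit `S₂^{(∞)}_{Ω_k}(0, z mod Ω_k) → S₂^{ℝ}(z)` and the Tannery passage for the constant test function (the susceptibility sum rule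
`Σ_z S₂^{ℝ}(z) = m⁻²`).  This file is the same passage for an ARBITRARY BOUNDED test function `h` on `ℤ^{d+1}` (read on the torus through part Ϝ-k's centred
representatives `w̃ = torRep w`): `Σ_{w∈Ω_k} S₂^{(∞)}_{Ω_k}(0,w)h(w̃) = Σ_z repKernel_{Ω_k}(z)h(z) → Σ_z S₂^{ℝ}(z)h(z)` (dominated convergence of series with the uniform
majorant `(m⁻² + 2∕γ)‖h‖_∞Π_ν e^{−(κ∕(d+1))|z_ν|}`).  `Σ_w S₂(0,w)h(w)` is the linear response of the Gaussian block field at the origin to the source `h`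
(equivalently `∂_{J(0)}` of King's `ln Z(J) = ½⟨J,S₂J⟩` at `J = h`), so this is the infinite-volume limit of the one-point function in a bounded external field.
NOT a node discharge (N15 is booked through n15-a's knit, untouched here); nothing Bałaban ∕ continuum-Yang–Mills ∕ `ℝ⁴` ∕ OS ∕ Clay.  0 `sorry`, 0 def; standard axioms.

WHAT THIS FILE PROVES (kernel).  ★ `tsum_repKernel_mul_eq_sum` (`Σ_z repKernel_Ω(z)h(z) = Σ_{w∈Ω} S₂^{(∞)}_Ω(0,w)h(w̃)`), `summable_kingS2Inf_mul` , ★★ **`tendsto_tsum_repKernel_mul`**,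
★★★ **`tendsto_sum_kingS2Lim_mul_volume`** (THE RESPONSE LIMIT: `Σ_{w∈Ω_k}S₂^{(∞)}_{Ω_k}(0,w)h(w̃) → Σ_z S₂^{ℝ}(z)h(z)` along any tori with all periods `→ ∞`, every bounded `h`),
★ `abs_tsum_kingS2Inf_mul_le` (`|Σ_z S₂^{ℝ}(z)h(z)| ≤ ‖h‖_∞·Σ_z|S₂^{ℝ}(z)|`).

HONEST SCOPE.  King's free model; bounded test functions only; no rate.  N15 untouched; counts unmoved.  Locators (use): [King1986] Thm 2.1 (2.22)–(2.23) p.654, (4.5) p.670,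
Thm 3.3 (3.6) p.655.
-/

noncomputable section

open scoped BigOperators Topology
open Finset Filter

namespace Summit.QuantumFields.YangMills.BalabanUVNodes.N15KingModelRung

open Literature.MathematicalPhysics.QuantumFieldTheory.Balaban1983to89.B5Prop11Plancherel (Tor)
open Literature.MathematicalPhysics.QuantumFieldTheory.King1986.Torus

variable {d : ℕ}

/-- ★ **The transported kernel against a test function is the torus sum**: `Σ_z repKernel_Ω(z)·h(z) = Σ_{w∈Ω} S₂^{(∞)}_Ω(0,w)·h(w̃)`, `w̃ = torRep w` (the transported
kernel is supported on the centred representatives). [cite: King1986, (4.5) p.670] -/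
theorem tsum_repKernel_mul_eq_sum (M : Fin (d + 1) → ℕ) [∀ ν, NeZero (M ν)] (m2 : ℝ) (h : (Fin (d + 1) → ℤ) → ℝ) :
    ∑' z : Fin (d + 1) → ℤ, repKernel M m2 z * h z = ∑ w : Tor M, kingS2Lim M m2 0 w * h (torRep M w) := by
  have hsupp : Function.support (fun z => repKernel M m2 z * h z) ⊆ Set.range (torRep M) := by
    intro z hz
    rw [Function.mem_support] at hz
    have hz' : repKernel M m2 z ≠ 0 := fun h0 => hz (by rw [h0, zero_mul])
    unfold repKernel at hz'
    by_cases hr : torRep M (fun ν => ((z ν : ℤ) : ZMod (M ν))) = z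
    · exact ⟨_, hr⟩
    · rw [if_neg hr] at hz'; exact absurd rfl hz'
  rw [← (torRep_injective M).tsum_eq hsupp, tsum_fintype]
  simp_rw [repKernel_torRep]

/-- `z ↦ S₂^{ℝ}(z)h(z)` is summable for bounded `h`. [folklore] -/
theorem summable_kingS2Inf_mul {m2 : ℝ} (hm : 0 < m2) {h : (Fin (d + 1) → ℤ) → ℝ} {B : ℝ} (hB : ∀ z, |h z| ≤ B) :
    Summable fun z : Fin (d + 1) → ℤ => kingS2Inf m2 z * h z := by
  refine ((summable_kingS2Inf hm).abs.mul_right B).of_norm_bounded (fun z => ?_)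
  rw [Real.norm_eq_abs, abs_mul]
  exact mul_le_mul_of_nonneg_left (hB z) (abs_nonneg _)

/-- ★★ **TANNERY FOR A BOUNDED TEST FUNCTION**: along any tori with all periods `→ ∞`, `Σ_z repKernel_{Ω_k}(z)h(z) → Σ_z S₂^{ℝ}(z)h(z)` (`|h| ≤ B`; dominated
convergence of series under part Ϝ-k's uniform majorant). [cite: King1986, Thm 2.1 (2.22)–(2.23) p.654, Thm 3.3 (3.6) p.655] -/
theorem tendsto_tsum_repKernel_mul {m2 : ℝ} (hm : 0 < m2) (Mseq : ℕ → Fin (d + 1) → ℕ) (hpos : ∀ k ν, 0 < Mseq k ν)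
    (hlim : ∀ ν, Tendsto (fun k => (Mseq k ν : ℝ)) atTop atTop) {h : (Fin (d + 1) → ℤ) → ℝ} {B : ℝ} (hB : ∀ z, |h z| ≤ B) :
    Tendsto (fun k => haveI : ∀ ν, NeZero (Mseq k ν) := fun ν => ⟨(hpos k ν).ne'⟩
      ∑' z : Fin (d + 1) → ℤ, repKernel (Mseq k) m2 z * h z) atTop (𝓝 (∑' z : Fin (d + 1) → ℤ, kingS2Inf m2 z * h z)) := by
  have hL : 2 ≤ 3 := by norm_num
  have hLodd : Odd 3 := by decide
  have hκ : 0 < kapM (d + 1) 1 m2 3 := (kapM_pos_le (d := d + 1) one_pos hm hL).1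
  have hκ' : 0 < kapM (d + 1) 1 m2 3 / (d + 1 : ℕ) := by positivity
  have hB0 : 0 ≤ B := (abs_nonneg _).trans (hB 0)
  exact tendsto_tsum_of_dominated_convergence (𝓕 := atTop)
    (f := fun k z => haveI : ∀ ν, NeZero (Mseq k ν) := fun ν => ⟨(hpos k ν).ne'⟩; repKernel (Mseq k) m2 z * h z)
    (g := fun z => kingS2Inf m2 z * h z) (((summable_prod_exp_neg_abs hκ').mul_left (m2⁻¹ + 2 / gamM 1 m2 3)).mul_right B)
    (fun z => (tendsto_repKernel hm Mseq hpos hlim z).mul_const (h z))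
    (Filter.Eventually.of_forall fun k z => by
      haveI : ∀ ν, NeZero (Mseq k ν) := fun ν => ⟨(hpos k ν).ne'⟩
      rw [Real.norm_eq_abs, abs_mul]
      exact mul_le_mul (abs_repKernel_le 3 hLodd hL one_pos hm (Mseq k) z) (hB z) (abs_nonneg _)
        (mul_nonneg (by have := gamM_pos (a := (1 : ℝ)) one_pos hm hL; positivity) (Finset.prod_nonneg fun ν _ => (Real.exp_pos _).le)))

/-- ★★★ **THE THERMODYNAMIC LIMIT OF THE LINEAR RESPONSE AT THE ORIGIN**: for every bounded source `h : ℤ^{d+1} → ℝ` (`|h| ≤ B`) and ANY tori `Ω_k` with all periods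
`→ ∞`, `Σ_{w∈Ω_k} S₂^{(∞)}_{Ω_k}(0,w)·h(w̃) → Σ_{z∈ℤ^{d+1}} S₂^{ℝ}(z)·h(z)` — the one-point function of the free block field at `0` in the external field `h` (read on `Ω_k`
through centred representatives) converges to its infinite-volume value. [cite: King1986, Thm 2.1 (2.22)–(2.23) p.654, (4.5) p.670] -/
theorem tendsto_sum_kingS2Lim_mul_volume {m2 : ℝ} (hm : 0 < m2) (Mseq : ℕ → Fin (d + 1) → ℕ) (hpos : ∀ k ν, 0 < Mseq k ν)
    (hlim : ∀ ν, Tendsto (fun k => (Mseq k ν : ℝ)) atTop atTop) {h : (Fin (d + 1) → ℤ) → ℝ} {B : ℝ} (hB : ∀ z, |h z| ≤ B) :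
    Tendsto (fun k => haveI : ∀ ν, NeZero (Mseq k ν) := fun ν => ⟨(hpos k ν).ne'⟩
      ∑ w : Tor (Mseq k), kingS2Lim (Mseq k) m2 0 w * h (torRep (Mseq k) w)) atTop (𝓝 (∑' z : Fin (d + 1) → ℤ, kingS2Inf m2 z * h z)) := by
  refine (tendsto_tsum_repKernel_mul hm Mseq hpos hlim hB).congr fun k => ?_
  haveI : ∀ ν, NeZero (Mseq k ν) := fun ν => ⟨(hpos k ν).ne'⟩
  exact tsum_repKernel_mul_eq_sum (Mseq k) m2 h

/-- ★ The infinite-volume response is bounded by `‖h‖_∞` times the (absolute) susceptibility: `|Σ_z S₂^{ℝ}(z)h(z)| ≤ B·Σ_z|S₂^{ℝ}(z)|`. [folklore] -/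
theorem abs_tsum_kingS2Inf_mul_le {m2 : ℝ} (hm : 0 < m2) {h : (Fin (d + 1) → ℤ) → ℝ} {B : ℝ} (hB : ∀ z, |h z| ≤ B) :
    |∑' z : Fin (d + 1) → ℤ, kingS2Inf m2 z * h z| ≤ B * ∑' z : Fin (d + 1) → ℤ, |kingS2Inf m2 z| := by
  have hs := summable_kingS2Inf_mul hm hB
  have habs := (summable_kingS2Inf (d := d) hm).abs
  calc |∑' z, kingS2Inf m2 z * h z| ≤ ∑' z, |kingS2Inf m2 z * h z| := by
        have := norm_tsum_le_tsum_norm hs.norm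
        simpa only [Real.norm_eq_abs] using this
    _ ≤ ∑' z, B * |kingS2Inf m2 z| := by
        refine hs.abs.tsum_le_tsum (fun z => ?_) (habs.mul_left B)
        rw [abs_mul, mul_comm]
        exact mul_le_mul_of_nonneg_right (hB z) (abs_nonneg _)
    _ = B * ∑' z, |kingS2Inf m2 z| := tsum_mul_left

end Summit.QuantumFields.YangMills.BalabanUVNodes.N15KingModelRung
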